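import Literature.NumberTheory.Automorphic.Liu2021.SplitPlaceHeckeEigenvaluesAtLine
import Literature.NumberTheory.Automorphic.Liu2021.SplitPlaceHeckeEigenvalueReadings
import Literature.RepresentationTheory.Liu2021.OscillatorConventions
import HarnessLib

/-!
# [Liu2021, Lem. D.1 (2)] at a split place for the two CM carriers, read in the labels of [Liu2021, Thm. D.6 (1)]

Topic `Literature/NumberTheory/Automorphic/Liu2021`; proof file (two theorems: no definition, no named fact, no instance, no
`sorry`); count-neutral.  Written for the d6 line of cell `hodgecm-mathlib` (flag «F-orient», leg (S-i)); HC_CM is NOT proved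
by anything here.

★ `Liu2021.splitPlace_heckeOperator_localInt_apply_localSplittingCM_comp_localLineInl` gives, for the CM section
`s_v = localSplittingCM L 2 … θ hθ v` attached to a unitary oscillator character `θ` of the CM field `L`, the two local Hecke
eigen-equations of the `χc`-coinvariants of `ω_v ∘ s_v` pulled back along `localLineInl v`, on `U(J_V)(𝒪_v)`-fixed vectors, with
scalars `√q_w (θ_w(ϖ) + χ′(ϖ) θ_w(ϖ)⁻¹)` and `χ′(ϖ)`.  Here `θ` is specialised to the two characters the d6 line considers, for a
CONJUGATE-SYMPLECTIC unitary idele class character `μ` ([Liu2021, Def. 4.1, Rem. 4.2, Rem. 4.4]), `ϖ` to the chosen uniformiser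
`ϖ_w`, and `χ′` to the `w`-component of a Hecke character `η` (in the d6 line `η = χ̌`, ★ `forall_localComponent_checkOfChi_det`),
and the scalars are READ in the currency of [Liu2021, Thm. D.6 (1)] (`valueAtUniformizer`, `μ^{alg} = μ|·|^{-1/2}`,
`(μ^{alg})ᶜ`; ★ `SplitPlaceHeckeEigenvalueReadings`):

* `…_galConj_labels` — **carrier on `θ := μᶜ`** (`toHeckeCharacter (galConj c μ)`, the splitting the registered
  `thmD6OneCurveCUF` carrier is built on): `T_{w,1} y = ((μ^{alg})ᶜ(ϖ_w) + (μ^{alg}·η)(ϖ_w)) • y` and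
  `N(w) • T_{w,2} y = ((μ^{alg})ᶜ(ϖ_w) · (μ^{alg}·η)(ϖ_w)) • y`;
* `…_labels` — **carrier on `θ := μ`** (`toHeckeCharacter μ`): `T_{w,1} y = (μ^{alg}(ϖ_w) + ((μ^{alg})ᶜ·η)(ϖ_w)) • y` and
  `N(w) • T_{w,2} y = (μ^{alg}(ϖ_w) · ((μ^{alg})ᶜ·η)(ϖ_w)) • y` — the printed pair `μ₁ = μ|·|^{-1/2}`, `μ₂ = μᶜχ̌|·|^{-1/2}` of
  [Liu2021, Thm. D.6 (1)] (proof, l. 5624) at `η = χ̌`.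

The CROSSED reading (carrier on `μᶜ`, printed pair `(μ^{alg}, (μ^{alg})ᶜ·η)`) is NOT a theorem: by ★ `galConj_labels_sub_labels`
it differs from `…_galConj_labels` by `√N(w)(μ(ϖ_w) − μ(ϖ_w)⁻¹)(η(ϖ_w) − 1) • y`.  (For the referees' refuse-control: replacing the
right-hand sides of `…_galConj_labels` by those of `…_labels` leaves, after the same proof script, the unprovable goal
`(galConj c μ^{alg})(ϖ_w) + (μ^{alg}·η)(ϖ_w) = μ^{alg}(ϖ_w) + ((galConj c μ^{alg})·η)(ϖ_w)`.)

## References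
* Y. Liu, *Fourier–Jacobi cycles and arithmetic relative trace formula*, Camb. J. Math. 9 (2021): App. D, Lemma D.1 (2) and
  its proof, first paragraph (l. 5241, p. 126); Thm. D.6 (1) (l. 5436–5443) and its proof (l. 5624); Def. 4.1, Rem. 4.2,
  Rem. 4.4. [Liu2021]
* S. Gelbart, J. Rogawski, Invent. Math. 105 (1991), §3.2 p. 457. [GelbartRogawski1991]
* P. Cartier, PSPM 33 (1979), part 1, §IV.1. [CartierCorvallis1979]
-/

set_option autoImplicit false

noncomputable section

open scoped Matrix Kronecker
open NumberField IsDedekindDomain Matrix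
open _root_.MeasureTheory
open scoped MatrixGroups
open ValuativeRel
open Literature.RepresentationTheory (TwistedCoinv.rep TwistedCoinv.Coinv TwistedCoinv.mk)
open Literature.RepresentationTheory.HeisenbergGroup (MpPsi)
open Literature.NumberTheory.Automorphic.Zelevinsky1980 (lastBlockLabel)
open Literature.NumberTheory.Automorphic Literature.NumberTheory.Automorphic.UnitaryGroup
open Literature.NumberTheory.Automorphic.IdeleClassGroup
open Literature.NumberTheory.GelbartRogawski1991.UnitaryDualPair
open Literature.NumberTheory.GelbartRogawski1991.UnitaryDualPair.LocalSplitting (localSchrodinger localSplittingCM LocalMp)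
open Literature.NumberTheory.GelbartRogawski1991.GRConstruction
open Literature.RepresentationTheory.HarrisKudlaSweet1996 Literature.NumberTheory.GaloisRepresentations
open Literature.RepresentationTheory.Liu2021

namespace Literature.NumberTheory.Automorphic.Liu2021

set_option maxHeartbeats 2000000 in -- as in `SplitPlaceHeckeEigenvaluesAtLine`: the explicit model's ≈ 40 heavy binders
/-- **[Liu2021, Lem. D.1 (2)] at a split place for the carrier on `θ := μᶜ`, in the labels of [Liu2021, Thm. D.6 (1)].**
For `μ` conjugate symplectic, the CM section attached to `toHeckeCharacter (galConj c μ)`, a split `w ∣ v` of good reduction,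
a unitary continuous central character `χc` whose `w`-reading is the `w`-component of a Hecke character `η`
(`η_w(det z_w) = χc z`), on every `U(J_V)(𝒪_v)`-fixed vector `y` of `(χc-coinvariants of ω_v ∘ s) ∘ localLineInl v`:
`T_{w,1} y = ((μ^{alg})ᶜ(ϖ_w) + (μ^{alg}·η)(ϖ_w)) • y` and `N(w) • T_{w,2} y = ((μ^{alg})ᶜ(ϖ_w)·(μ^{alg}·η)(ϖ_w)) • y`
(`T_{w,i}` = the double coset operator of `e_w^{V,-1}(diag)` at the chosen uniformiser `ϖ_w`).
[cite: Liu2021, App. D, Lemma D.1 (2) and proof of Lemma D.1, first paragraph (l. 5241, p. 126); Thm. D.6 (1) (l. 5436–5443) and proof (l. 5624); Def. 4.1; Remark 4.4]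
[cite: GelbartRogawski1991, §3.2 p. 457] [cite: CartierCorvallis1979, §IV.1] -/
theorem splitPlace_heckeOperator_localInt_apply_comp_localLineInl_galConj_labels
    (L : Type) [Field L] [NumberField L] [IsCMField L] (hc1 : IsCMField.complexConj L ≠ 1)
    (JV : Matrix (Fin 2) (Fin 2) L) (JW : Matrix (Fin 1) (Fin 1) L) (hJW0 : JW 0 0 ≠ 0)
    (T₀ : Matrix (Fin 2) (Fin 2) (maximalRealSubfield L)) (hT₀ : T₀.IsSymm) (hT₀d : IsUnit T₀.det)
    (t : Fin 2 → maximalRealSubfield L) (hT₀t : T₀ = Matrix.diagonal t)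
    (hJ : Matrix.reindex (finProdFinEquiv : Fin 2 × Fin 1 ≃ Fin 2) finProdFinEquiv (JV ⊗ₖ JW) =
      T₀.map (algebraMap (maximalRealSubfield L) L))
    (hJVh : (JV.map (IsCMField.complexConj L))ᵀ = JV)
    (hJh : ((Matrix.reindex (finProdFinEquiv : Fin 2 × Fin 1 ≃ Fin 2) finProdFinEquiv (JV ⊗ₖ JW)).map
      (IsCMField.complexConj L))ᵀ = Matrix.reindex (finProdFinEquiv : Fin 2 × Fin 1 ≃ Fin 2) finProdFinEquiv (JV ⊗ₖ JW))
    (v : HeightOneSpectrum (𝓞 (maximalRealSubfield L))) (w : UnitaryGroup.PlacesOver L v)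
    (hw : IsCMField.complexConj L • (w : HeightOneSpectrum (𝓞 L)) ≠ w)
    (hJVw : IsUnit (UnitaryGroup.placeForm JV (w : HeightOneSpectrum (𝓞 L))))
    (hJw : IsUnit (UnitaryGroup.placeForm
      (Matrix.reindex (finProdFinEquiv : Fin 2 × Fin 1 ≃ Fin 2) finProdFinEquiv (JV ⊗ₖ JW)) (w : HeightOneSpectrum (𝓞 L))))
    (hJi : hJw.unit ∈ glInt 2 ((w : HeightOneSpectrum (𝓞 L)).adicCompletion L))
    (μ : IdeleClassGroup L →ₜ* Circle) (hμ : IsConjugateSymplectic L μ)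
    (s : UnitaryGroup.localPi L (IsCMField.complexConj L) 2
        (Matrix.reindex (finProdFinEquiv : Fin 2 × Fin 1 ≃ Fin 2) finProdFinEquiv (JV ⊗ₖ JW)) v →*
      LocalMp (maximalRealSubfield L) 2 T₀ v)
    (hs : s = localSplittingCM L 2 hT₀ hT₀d hJ (toHeckeCharacter L (galConj (IsCMField.complexConj L) μ))
      ((isOscillatorChar_toHeckeCharacter_iff (galConj (IsCMField.complexConj L) μ)).mpr hμ.galConj) v)
    [LocallyCompactSpace (standardParabolicGL ((w : HeightOneSpectrum (𝓞 L)).adicCompletion L)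
      (Zelevinsky1980.lastBlockLabel 2))]
    (χc : UnitaryGroup.localPi L (IsCMField.complexConj L) 1 JW v →* ℂˣ) (hχcu : ∀ z, ‖((χc z : ℂˣ) : ℂ)‖ = 1)
    (hχcc : Continuous fun z => ((χc z : ℂˣ) : ℂ))
    (η : HeckeCharacter L)
    (hη : ∀ z : UnitaryGroup.localPi L (IsCMField.complexConj L) 1 JW v,
      η.localComponent (w : HeightOneSpectrum (𝓞 L)) (Matrix.GeneralLinearGroup.det ((z : UnitaryGroup.LocalGLPi L 1 v) w)) =
        χc z)
    {y : TwistedCoinv.Coinv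
      (show Representation ℂ (UnitaryGroup.localPi L (IsCMField.complexConj L) 1 JW v)
          (SchwartzBruhat (Fin 2 → v.adicCompletion (maximalRealSubfield L))) from
        ((MpPsi.toRep (localSchrodinger (maximalRealSubfield L) 2 T₀ v)).comp s).comp
          (UnitaryGroup.localCenter L (IsCMField.complexConj L) 2
            (Matrix.reindex (finProdFinEquiv : Fin 2 × Fin 1 ≃ Fin 2) finProdFinEquiv (JV ⊗ₖ JW)) JW hJW0 v)) χc}
    (hy : y ∈ Representation.fixedPoints
      ((TwistedCoinv.rep
        (ρW := show Representation ℂ (UnitaryGroup.localPi L (IsCMField.complexConj L) 1 JW v)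
            (SchwartzBruhat (Fin 2 → v.adicCompletion (maximalRealSubfield L))) from
          ((MpPsi.toRep (localSchrodinger (maximalRealSubfield L) 2 T₀ v)).comp s).comp
            (UnitaryGroup.localCenter L (IsCMField.complexConj L) 2
              (Matrix.reindex (finProdFinEquiv : Fin 2 × Fin 1 ≃ Fin 2) finProdFinEquiv (JV ⊗ₖ JW)) JW hJW0 v))
        χc ((MpPsi.toRep (localSchrodinger (maximalRealSubfield L) 2 T₀ v)).comp s)
        (fun g z => (show Commute g (UnitaryGroup.localCenter L (IsCMField.complexConj L) 2
            (Matrix.reindex (finProdFinEquiv : Fin 2 × Fin 1 ≃ Fin 2) finProdFinEquiv (JV ⊗ₖ JW)) JW hJW0 v z) from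
          UnitaryGroup.localCenter_comm L (IsCMField.complexConj L) 2 _ JW hJW0 v z g).map
          ((MpPsi.toRep (localSchrodinger (maximalRealSubfield L) 2 T₀ v)).comp s))).comp
        (localLineInl L (IsCMField.complexConj L) 2 (finProdFinEquiv : Fin 2 × Fin 1 ≃ Fin 2) JV JW v))
      (UnitaryGroup.localInt L (IsCMField.complexConj L) 2 JV v)) :
    heckeOperator
        ((TwistedCoinv.rep
          (ρW := show Representation ℂ (UnitaryGroup.localPi L (IsCMField.complexConj L) 1 JW v)
              (SchwartzBruhat (Fin 2 → v.adicCompletion (maximalRealSubfield L))) from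
            ((MpPsi.toRep (localSchrodinger (maximalRealSubfield L) 2 T₀ v)).comp s).comp
              (UnitaryGroup.localCenter L (IsCMField.complexConj L) 2
                (Matrix.reindex (finProdFinEquiv : Fin 2 × Fin 1 ≃ Fin 2) finProdFinEquiv (JV ⊗ₖ JW)) JW hJW0 v))
          χc ((MpPsi.toRep (localSchrodinger (maximalRealSubfield L) 2 T₀ v)).comp s)
          (fun g z => (show Commute g (UnitaryGroup.localCenter L (IsCMField.complexConj L) 2
              (Matrix.reindex (finProdFinEquiv : Fin 2 × Fin 1 ≃ Fin 2) finProdFinEquiv (JV ⊗ₖ JW)) JW hJW0 v z) from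
            UnitaryGroup.localCenter_comm L (IsCMField.complexConj L) 2 _ JW hJW0 v z g).map
            ((MpPsi.toRep (localSchrodinger (maximalRealSubfield L) 2 T₀ v)).comp s))).comp
          (localLineInl L (IsCMField.complexConj L) 2 (finProdFinEquiv : Fin 2 × Fin 1 ≃ Fin 2) JV JW v))
        (UnitaryGroup.localInt L (IsCMField.complexConj L) 2 JV v)
        ((UnitaryGroup.localPiSplitEquiv (IsCMField.complexConj L) JV hc1 hJVh w hw hJVw).symm
          (heckeDiag 2 (HeckeCharacter.uniformizer L (w : HeightOneSpectrum (𝓞 L))) 1)) y =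
        ((HeckeCharacter.galConj (IsCMField.complexConj L) (muAlg L μ)).valueAtUniformizer (w : HeightOneSpectrum (𝓞 L)) +
          (muAlg L μ * η).valueAtUniformizer (w : HeightOneSpectrum (𝓞 L))) • y ∧
      (Ideal.absNorm (w : HeightOneSpectrum (𝓞 L)).asIdeal : ℂ) •
        heckeOperator
          ((TwistedCoinv.rep
            (ρW := show Representation ℂ (UnitaryGroup.localPi L (IsCMField.complexConj L) 1 JW v)
                (SchwartzBruhat (Fin 2 → v.adicCompletion (maximalRealSubfield L))) from
              ((MpPsi.toRep (localSchrodinger (maximalRealSubfield L) 2 T₀ v)).comp s).comp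
                (UnitaryGroup.localCenter L (IsCMField.complexConj L) 2
                  (Matrix.reindex (finProdFinEquiv : Fin 2 × Fin 1 ≃ Fin 2) finProdFinEquiv (JV ⊗ₖ JW)) JW hJW0 v))
            χc ((MpPsi.toRep (localSchrodinger (maximalRealSubfield L) 2 T₀ v)).comp s)
            (fun g z => (show Commute g (UnitaryGroup.localCenter L (IsCMField.complexConj L) 2
                (Matrix.reindex (finProdFinEquiv : Fin 2 × Fin 1 ≃ Fin 2) finProdFinEquiv (JV ⊗ₖ JW)) JW hJW0 v z) from
              UnitaryGroup.localCenter_comm L (IsCMField.complexConj L) 2 _ JW hJW0 v z g).map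
              ((MpPsi.toRep (localSchrodinger (maximalRealSubfield L) 2 T₀ v)).comp s))).comp
            (localLineInl L (IsCMField.complexConj L) 2 (finProdFinEquiv : Fin 2 × Fin 1 ≃ Fin 2) JV JW v))
          (UnitaryGroup.localInt L (IsCMField.complexConj L) 2 JV v)
          ((UnitaryGroup.localPiSplitEquiv (IsCMField.complexConj L) JV hc1 hJVh w hw hJVw).symm
            (heckeDiag 2 (HeckeCharacter.uniformizer L (w : HeightOneSpectrum (𝓞 L))) 2)) y =
        ((HeckeCharacter.galConj (IsCMField.complexConj L) (muAlg L μ)).valueAtUniformizer (w : HeightOneSpectrum (𝓞 L)) *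
          (muAlg L μ * η).valueAtUniformizer (w : HeightOneSpectrum (𝓞 L))) • y := by
  have hϖ := isUniformizingElement_heckeCharacterUniformizer L (w : HeightOneSpectrum (𝓞 L))
  have h12 := splitPlace_heckeOperator_localInt_apply_localSplittingCM_comp_localLineInl L hc1 JV JW hJW0 T₀ hT₀ hT₀d t
    hT₀t hJ hJVh hJh v w hw hJVw hJw hJi (toHeckeCharacter L (galConj (IsCMField.complexConj L) μ))
    ((isOscillatorChar_toHeckeCharacter_iff (galConj (IsCMField.complexConj L) μ)).mpr hμ.galConj)
    (isUnitary_toHeckeCharacter L _) s hs χc hχcu hχcc (η.localComponent (w : HeightOneSpectrum (𝓞 L))) hη hϖ hy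
  have key := IdeleClassGroup.IsConjugateSymplectic.eigen_eq_galConj_labels_of_chain hμ η (w : HeightOneSpectrum (𝓞 L))
    hϖ.ne_zero h12.1 h12.2
  -- transport `Units.mk0 ↑ϖ_w _ = ϖ_w` through the (small) group element only, never through the carrier
  have hg : ∀ i : ℕ, (UnitaryGroup.localPiSplitEquiv (IsCMField.complexConj L) JV hc1 hJVh w hw hJVw).symm
        (heckeDiag 2 (Units.mk0 ((HeckeCharacter.uniformizer L (w : HeightOneSpectrum (𝓞 L)) :
          ((w : HeightOneSpectrum (𝓞 L)).adicCompletion L)ˣ) : (w : HeightOneSpectrum (𝓞 L)).adicCompletion L) hϖ.ne_zero) i) =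
      (UnitaryGroup.localPiSplitEquiv (IsCMField.complexConj L) JV hc1 hJVh w hw hJVw).symm
        (heckeDiag 2 (HeckeCharacter.uniformizer L (w : HeightOneSpectrum (𝓞 L))) i) := fun i => by
    rw [Units.mk0_val]
  exact ⟨(congrArg (fun g => heckeOperator _ _ g y) (hg 1)).symm.trans key.1,
    (congrArg (fun z => (Ideal.absNorm (w : HeightOneSpectrum (𝓞 L)).asIdeal : ℂ) • z)
      (congrArg (fun g => heckeOperator _ _ g y) (hg 2)).symm).trans key.2⟩

set_option maxHeartbeats 2000000 in -- as in `SplitPlaceHeckeEigenvaluesAtLine`: the explicit model's ≈ 40 heavy binders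
/-- **[Liu2021, Lem. D.1 (2)] at a split place for the carrier on `θ := μ`, in the labels of [Liu2021, Thm. D.6 (1)]** — the
printed pair `μ₁ = μ|·|^{-1/2}`, `μ₂ = μᶜχ̌|·|^{-1/2}` (l. 5624) at `η = χ̌`: with the CM section attached to `toHeckeCharacter μ`,
`T_{w,1} y = (μ^{alg}(ϖ_w) + ((μ^{alg})ᶜ·η)(ϖ_w)) • y` and `N(w) • T_{w,2} y = (μ^{alg}(ϖ_w)·((μ^{alg})ᶜ·η)(ϖ_w)) • y`.
[cite: Liu2021, App. D, Lemma D.1 (2) and proof of Lemma D.1, first paragraph (l. 5241, p. 126); Thm. D.6 (1) (l. 5436–5443) and proof (l. 5624); Def. 4.1]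
[cite: GelbartRogawski1991, §3.2 p. 457] [cite: CartierCorvallis1979, §IV.1] -/
theorem splitPlace_heckeOperator_localInt_apply_comp_localLineInl_labels
    (L : Type) [Field L] [NumberField L] [IsCMField L] (hc1 : IsCMField.complexConj L ≠ 1)
    (JV : Matrix (Fin 2) (Fin 2) L) (JW : Matrix (Fin 1) (Fin 1) L) (hJW0 : JW 0 0 ≠ 0)
    (T₀ : Matrix (Fin 2) (Fin 2) (maximalRealSubfield L)) (hT₀ : T₀.IsSymm) (hT₀d : IsUnit T₀.det)
    (t : Fin 2 → maximalRealSubfield L) (hT₀t : T₀ = Matrix.diagonal t)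
    (hJ : Matrix.reindex (finProdFinEquiv : Fin 2 × Fin 1 ≃ Fin 2) finProdFinEquiv (JV ⊗ₖ JW) =
      T₀.map (algebraMap (maximalRealSubfield L) L))
    (hJVh : (JV.map (IsCMField.complexConj L))ᵀ = JV)
    (hJh : ((Matrix.reindex (finProdFinEquiv : Fin 2 × Fin 1 ≃ Fin 2) finProdFinEquiv (JV ⊗ₖ JW)).map
      (IsCMField.complexConj L))ᵀ = Matrix.reindex (finProdFinEquiv : Fin 2 × Fin 1 ≃ Fin 2) finProdFinEquiv (JV ⊗ₖ JW))
    (v : HeightOneSpectrum (𝓞 (maximalRealSubfield L))) (w : UnitaryGroup.PlacesOver L v)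
    (hw : IsCMField.complexConj L • (w : HeightOneSpectrum (𝓞 L)) ≠ w)
    (hJVw : IsUnit (UnitaryGroup.placeForm JV (w : HeightOneSpectrum (𝓞 L))))
    (hJw : IsUnit (UnitaryGroup.placeForm
      (Matrix.reindex (finProdFinEquiv : Fin 2 × Fin 1 ≃ Fin 2) finProdFinEquiv (JV ⊗ₖ JW)) (w : HeightOneSpectrum (𝓞 L))))
    (hJi : hJw.unit ∈ glInt 2 ((w : HeightOneSpectrum (𝓞 L)).adicCompletion L))
    (μ : IdeleClassGroup L →ₜ* Circle) (hμ : IsConjugateSymplectic L μ)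
    (s : UnitaryGroup.localPi L (IsCMField.complexConj L) 2
        (Matrix.reindex (finProdFinEquiv : Fin 2 × Fin 1 ≃ Fin 2) finProdFinEquiv (JV ⊗ₖ JW)) v →*
      LocalMp (maximalRealSubfield L) 2 T₀ v)
    (hs : s = localSplittingCM L 2 hT₀ hT₀d hJ (toHeckeCharacter L μ)
      ((isOscillatorChar_toHeckeCharacter_iff μ).mpr hμ) v)
    [LocallyCompactSpace (standardParabolicGL ((w : HeightOneSpectrum (𝓞 L)).adicCompletion L)
      (Zelevinsky1980.lastBlockLabel 2))]
    (χc : UnitaryGroup.localPi L (IsCMField.complexConj L) 1 JW v →* ℂˣ) (hχcu : ∀ z, ‖((χc z : ℂˣ) : ℂ)‖ = 1)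
    (hχcc : Continuous fun z => ((χc z : ℂˣ) : ℂ))
    (η : HeckeCharacter L)
    (hη : ∀ z : UnitaryGroup.localPi L (IsCMField.complexConj L) 1 JW v,
      η.localComponent (w : HeightOneSpectrum (𝓞 L)) (Matrix.GeneralLinearGroup.det ((z : UnitaryGroup.LocalGLPi L 1 v) w)) =
        χc z)
    {y : TwistedCoinv.Coinv
      (show Representation ℂ (UnitaryGroup.localPi L (IsCMField.complexConj L) 1 JW v)
          (SchwartzBruhat (Fin 2 → v.adicCompletion (maximalRealSubfield L))) from
        ((MpPsi.toRep (localSchrodinger (maximalRealSubfield L) 2 T₀ v)).comp s).comp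
          (UnitaryGroup.localCenter L (IsCMField.complexConj L) 2
            (Matrix.reindex (finProdFinEquiv : Fin 2 × Fin 1 ≃ Fin 2) finProdFinEquiv (JV ⊗ₖ JW)) JW hJW0 v)) χc}
    (hy : y ∈ Representation.fixedPoints
      ((TwistedCoinv.rep
        (ρW := show Representation ℂ (UnitaryGroup.localPi L (IsCMField.complexConj L) 1 JW v)
            (SchwartzBruhat (Fin 2 → v.adicCompletion (maximalRealSubfield L))) from
          ((MpPsi.toRep (localSchrodinger (maximalRealSubfield L) 2 T₀ v)).comp s).comp
            (UnitaryGroup.localCenter L (IsCMField.complexConj L) 2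
              (Matrix.reindex (finProdFinEquiv : Fin 2 × Fin 1 ≃ Fin 2) finProdFinEquiv (JV ⊗ₖ JW)) JW hJW0 v))
        χc ((MpPsi.toRep (localSchrodinger (maximalRealSubfield L) 2 T₀ v)).comp s)
        (fun g z => (show Commute g (UnitaryGroup.localCenter L (IsCMField.complexConj L) 2
            (Matrix.reindex (finProdFinEquiv : Fin 2 × Fin 1 ≃ Fin 2) finProdFinEquiv (JV ⊗ₖ JW)) JW hJW0 v z) from
          UnitaryGroup.localCenter_comm L (IsCMField.complexConj L) 2 _ JW hJW0 v z g).map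
          ((MpPsi.toRep (localSchrodinger (maximalRealSubfield L) 2 T₀ v)).comp s))).comp
        (localLineInl L (IsCMField.complexConj L) 2 (finProdFinEquiv : Fin 2 × Fin 1 ≃ Fin 2) JV JW v))
      (UnitaryGroup.localInt L (IsCMField.complexConj L) 2 JV v)) :
    heckeOperator
        ((TwistedCoinv.rep
          (ρW := show Representation ℂ (UnitaryGroup.localPi L (IsCMField.complexConj L) 1 JW v)
              (SchwartzBruhat (Fin 2 → v.adicCompletion (maximalRealSubfield L))) from
            ((MpPsi.toRep (localSchrodinger (maximalRealSubfield L) 2 T₀ v)).comp s).comp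
              (UnitaryGroup.localCenter L (IsCMField.complexConj L) 2
                (Matrix.reindex (finProdFinEquiv : Fin 2 × Fin 1 ≃ Fin 2) finProdFinEquiv (JV ⊗ₖ JW)) JW hJW0 v))
          χc ((MpPsi.toRep (localSchrodinger (maximalRealSubfield L) 2 T₀ v)).comp s)
          (fun g z => (show Commute g (UnitaryGroup.localCenter L (IsCMField.complexConj L) 2
              (Matrix.reindex (finProdFinEquiv : Fin 2 × Fin 1 ≃ Fin 2) finProdFinEquiv (JV ⊗ₖ JW)) JW hJW0 v z) from
            UnitaryGroup.localCenter_comm L (IsCMField.complexConj L) 2 _ JW hJW0 v z g).map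
            ((MpPsi.toRep (localSchrodinger (maximalRealSubfield L) 2 T₀ v)).comp s))).comp
          (localLineInl L (IsCMField.complexConj L) 2 (finProdFinEquiv : Fin 2 × Fin 1 ≃ Fin 2) JV JW v))
        (UnitaryGroup.localInt L (IsCMField.complexConj L) 2 JV v)
        ((UnitaryGroup.localPiSplitEquiv (IsCMField.complexConj L) JV hc1 hJVh w hw hJVw).symm
          (heckeDiag 2 (HeckeCharacter.uniformizer L (w : HeightOneSpectrum (𝓞 L))) 1)) y =
        ((muAlg L μ).valueAtUniformizer (w : HeightOneSpectrum (𝓞 L)) +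
          (HeckeCharacter.galConj (IsCMField.complexConj L) (muAlg L μ) * η).valueAtUniformizer
            (w : HeightOneSpectrum (𝓞 L))) • y ∧
      (Ideal.absNorm (w : HeightOneSpectrum (𝓞 L)).asIdeal : ℂ) •
        heckeOperator
          ((TwistedCoinv.rep
            (ρW := show Representation ℂ (UnitaryGroup.localPi L (IsCMField.complexConj L) 1 JW v)
                (SchwartzBruhat (Fin 2 → v.adicCompletion (maximalRealSubfield L))) from
              ((MpPsi.toRep (localSchrodinger (maximalRealSubfield L) 2 T₀ v)).comp s).comp
                (UnitaryGroup.localCenter L (IsCMField.complexConj L) 2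
                  (Matrix.reindex (finProdFinEquiv : Fin 2 × Fin 1 ≃ Fin 2) finProdFinEquiv (JV ⊗ₖ JW)) JW hJW0 v))
            χc ((MpPsi.toRep (localSchrodinger (maximalRealSubfield L) 2 T₀ v)).comp s)
            (fun g z => (show Commute g (UnitaryGroup.localCenter L (IsCMField.complexConj L) 2
                (Matrix.reindex (finProdFinEquiv : Fin 2 × Fin 1 ≃ Fin 2) finProdFinEquiv (JV ⊗ₖ JW)) JW hJW0 v z) from
              UnitaryGroup.localCenter_comm L (IsCMField.complexConj L) 2 _ JW hJW0 v z g).map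
              ((MpPsi.toRep (localSchrodinger (maximalRealSubfield L) 2 T₀ v)).comp s))).comp
            (localLineInl L (IsCMField.complexConj L) 2 (finProdFinEquiv : Fin 2 × Fin 1 ≃ Fin 2) JV JW v))
          (UnitaryGroup.localInt L (IsCMField.complexConj L) 2 JV v)
          ((UnitaryGroup.localPiSplitEquiv (IsCMField.complexConj L) JV hc1 hJVh w hw hJVw).symm
            (heckeDiag 2 (HeckeCharacter.uniformizer L (w : HeightOneSpectrum (𝓞 L))) 2)) y =
        ((muAlg L μ).valueAtUniformizer (w : HeightOneSpectrum (𝓞 L)) *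
          (HeckeCharacter.galConj (IsCMField.complexConj L) (muAlg L μ) * η).valueAtUniformizer
            (w : HeightOneSpectrum (𝓞 L))) • y := by
  have hϖ := isUniformizingElement_heckeCharacterUniformizer L (w : HeightOneSpectrum (𝓞 L))
  have h12 := splitPlace_heckeOperator_localInt_apply_localSplittingCM_comp_localLineInl L hc1 JV JW hJW0 T₀ hT₀ hT₀d t
    hT₀t hJ hJVh hJh v w hw hJVw hJw hJi (toHeckeCharacter L μ) ((isOscillatorChar_toHeckeCharacter_iff μ).mpr hμ)
    (isUnitary_toHeckeCharacter L _) s hs χc hχcu hχcc (η.localComponent (w : HeightOneSpectrum (𝓞 L))) hη hϖ hy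
  have key := IdeleClassGroup.eigen_eq_labels_of_chain hμ.isConjugateSelfDual η (w : HeightOneSpectrum (𝓞 L))
    hϖ.ne_zero h12.1 h12.2
  have hg : ∀ i : ℕ, (UnitaryGroup.localPiSplitEquiv (IsCMField.complexConj L) JV hc1 hJVh w hw hJVw).symm
        (heckeDiag 2 (Units.mk0 ((HeckeCharacter.uniformizer L (w : HeightOneSpectrum (𝓞 L)) :
          ((w : HeightOneSpectrum (𝓞 L)).adicCompletion L)ˣ) : (w : HeightOneSpectrum (𝓞 L)).adicCompletion L) hϖ.ne_zero) i) =
      (UnitaryGroup.localPiSplitEquiv (IsCMField.complexConj L) JV hc1 hJVh w hw hJVw).symm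
        (heckeDiag 2 (HeckeCharacter.uniformizer L (w : HeightOneSpectrum (𝓞 L))) i) := fun i => by
    rw [Units.mk0_val]
  exact ⟨(congrArg (fun g => heckeOperator _ _ g y) (hg 1)).symm.trans key.1,
    (congrArg (fun z => (Ideal.absNorm (w : HeightOneSpectrum (𝓞 L)).asIdeal : ℂ) • z)
      (congrArg (fun g => heckeOperator _ _ g y) (hg 2)).symm).trans key.2⟩

end Literature.NumberTheory.Automorphic.Liu2021

end
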